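import Summits.Ventures.PercRepro.RankLevelSetLevelTenGXTBForm
import Summits.Ventures.PercRepro.RankLevelSetCoreTenOfFormGXT
import Summits.Ventures.PercRepro.RankLevelSetCoreTenLargeCorankGXTB
import Summits.Ventures.PercRepro.RankLevelSetLevelNineGXT
import Summits.Ventures.PercRepro.S3SixWindow

/-!
# PercRepro — THEOREM C₁₀ ON THE GIANT-EXACT COUNT WITH LEMMA T5: C-025 AT LEVEL `10` FOR EVERY FINITE MATROID AND EVERY
`p ≥ 403` — THE SECOND LEVEL-`10` CHAIN, AT THE FLAT-CELL FLOOR (p2, gen 35; a feeder for S4 — the top of the `q = 10` window, from `1,088`;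
the base-`430` chain is RankLevelSetLevelTenGXT)

The level-`10` instance of the GXT chains of RankLevelSetLevelEightGXT / RankLevelSetLevelNineGXT: p8 g18's giant-exact count
(`S2.ncard_eRk_eq_ncard_le_le_giant_exact`) with the quartic multiplicity on the non-giant rank-`10` sets and the powerset of the
giant flat, p8's LEMMA T5 (`s₅ ≤ 7·d(d+1)(d+2)(d+3)/48`), the flat bounds `f(10) ≤ 639`, `f(9) ≤ 319`
(RankLevelSetLevelTenInfraGXT): every cell `(p, d)`, `11 ≤ d ≤ 726`, closes at the UNIFORM base `p ≥ 403` (the 716 polynomial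
certificates of RankLevelSetLevelTenGXTBArith{AA…DL}, the exact tails of RankLevelSetLevelTenGXTBTails{AA…DW}, the dispatcher
`gxtb_form_ten`), and the large-corank regime closes from corank `727` (`largeTen_all_gxtb`); the rows `≤ 402` fail at the
`319`-point-flat cells `(p, 307 … 310)` on the `N`-side — `403` is the floor of the count; at the diagonal `d = D₀ − 1` the spanning
tail leaves `1.4·10^{−22}` of the budget (the form `(7329789236102279212953, 1)`).
* **`c025_core_ten_bounded_corank_gxtb`** — the `e`-free core at level `10`, corank `11 ≤ d ≤ 726`, rank `p ≥ 403`;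
* **`c025_ten_of_nine_gxtb_from`** — for every `P ≥ 403`: level `9` for all `p ≥ P` implies level `10` for all `p ≥ P + 1`;
* **`c025_ten_at_four_oh_three`** — level `10` at rank `403`, every finite matroid (the per-rank wrapper
  `rls_succ_large_at 9 10 403` on level `9` at `402`, `c025_nine_large_gxt'`);
* **`c025_ten_large_gxtb'`** — UNCONDITIONAL over the tree: level `10` for every `p ≥ 403`; **`c025_ten_large_gxtb`** the same
  in the literal `C025` body.
Axioms: standard.
-/

open scoped Matroid

namespace PercRepro

namespace ThmN

open Set

variable {α : Type}

/-- **The `e`-free core at level `10`, corank `11 ≤ d ≤ 726`, rank `p ≥ 403`, on the giant-exact count with LEMMA T5**: the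
form of the cell from `gxtb_form_ten` through `c025_core_ten_of_form_gxt`. -/
theorem c025_core_ten_bounded_corank_gxtb (M : Matroid α) [M.Finite] (p d : ℕ) (hp : 403 ≤ p) (hd11 : 11 ≤ d)
    (hd726 : d ≤ 726) (hR : M.eRank = (p : ℕ∞)) (hn : M.E.ncard = p + d)
    (hfree : ∀ e ∈ M.E, ∃ A ⊆ M.E \ {e}, e ∉ M.closure A ∧ e ∉ M.closure ((M.E \ {e}) \ A)) :
    RLS M p 10 :=
  c025_core_ten_of_form_gxt M p d hd11 hR hn hfree (gxtb_form_ten d hd11 hd726 p hp (p + d) (by omega))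

/-- **THEOREM C₁₀ ON THE GIANT-EXACT COUNT WITH LEMMA T5, GIVEN LEVEL `9` FROM `P`**: for every `P ≥ 403`, level `9` for all
`p ≥ P` implies level `10` for all `p ≥ P + 1` (the core at corank `11 ≤ d ≤ 726` by `c025_core_ten_bounded_corank_gxtb`, at
corank `≥ 727` by `c025_core_ten_large_corank_gxtb`; the coranks `≤ 10` are `U = ∅` or Theorem M). -/
theorem c025_ten_of_nine_gxtb_from (P : ℕ) (hP : 403 ≤ P)
    (h9 : ∀ (M : Matroid α) [M.Finite] (p : ℕ), P ≤ p → RLS M p 9) :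
    ∀ (M : Matroid α) [M.Finite] (p : ℕ), P + 1 ≤ p → RLS M p 10 := by
  intro M _ p hp
  refine rls_succ_large (α := α) 9 10 P ?_ ?_ ?_ M p hp (by omega)
  · intro M' _ p' hP' _
    exact h9 M' p' hP'
  · intro M' _ p' _ hn _
    rcases Nat.lt_or_ge M'.E.ncard (p' + 10) with h | h
    · exact RLS_of_ncard_lt M' h
    · exact RLS_of_ncard_eq M' (by omega)
  · intro M' _ p' hP' hR hbig _ hfree
    rcases Nat.lt_or_ge M'.E.ncard (p' + 727) with h | h
    · exact c025_core_ten_bounded_corank_gxtb M' p' (M'.E.ncard - p') (by omega) (by omega) (by omega) hR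
        (by omega) hfree
    · exact c025_core_ten_large_corank_gxtb M' p' (by omega) hR (by omega) hfree

/-- **Level `10` at rank `403`, every finite matroid**: `rls_succ_large_at 9 10 403` on level `9` at `402`
(`c025_nine_large_gxt'`), the coranks `≤ 10` (`U = ∅` or Theorem M) and the core at `403`. -/
theorem c025_ten_at_four_oh_three (M : Matroid α) [M.Finite] : RLS M 403 10 := by
  refine rls_succ_large_at (α := α) 9 10 403 (by norm_num)
    (fun M _ => c025_nine_large_gxt' M 402 (by norm_num)) ?_ ?_ M
  · -- corank `≤ 10`: `U = ∅` or Theorem M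
    intro M _ hn
    rcases Nat.lt_or_ge M.E.ncard (403 + 10) with h | h
    · exact RLS_of_ncard_lt M h
    · exact RLS_of_ncard_eq M (by omega)
  · -- the core at corank `≥ 11`
    intro M _ hR hbig hfree
    rcases Nat.lt_or_ge M.E.ncard (403 + 727) with h | h
    · exact c025_core_ten_bounded_corank_gxtb M 403 (M.E.ncard - 403) (le_refl _) (by omega) (by omega) hR
        (by omega) hfree
    · exact c025_core_ten_large_corank_gxtb M 403 (le_refl _) hR (by omega) hfree

/-- **THEOREM C₁₀ AT `403`, UNCONDITIONAL OVER THE TREE**: every finite matroid satisfies C-025 at level `10` for every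
`p ≥ 403` — the row `403` by `c025_ten_at_four_oh_three`, the rows `≥ 404` through the wrapper at `P = 403` on level `9` for
`p ≥ 208` (`c025_nine_large_gxt'`). -/
theorem c025_ten_large_gxtb' (M : Matroid α) [M.Finite] (p : ℕ) (hp : 403 ≤ p) : RLS M p 10 := by
  rcases Nat.lt_or_ge p 404 with h | h
  · have h403 : p = 403 := by omega
    subst h403
    exact c025_ten_at_four_oh_three M
  · exact c025_ten_of_nine_gxtb_from 403 (by norm_num)
      (fun M' _ p' hp' => c025_nine_large_gxt' M' p' (by omega)) M p h

/-- The same in the literal `C025` body: `phiK p 10 · #U(p, 10) ≤ #Y(p, 10)` for every finite matroid and every `p ≥ 403`. -/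
theorem c025_ten_large_gxtb (M : Matroid α) [M.Finite] (p : ℕ) (hp : 403 ≤ p) :
    phiK p 10 * ({A : Set α | A ⊆ M.E ∧ M.eRk A = (p : ℕ∞) ∧ M.eRk (M.E \ A) = (10 : ℕ∞)}.ncard : ℚ) ≤
      ({A : Set α | A ⊆ M.E ∧ (10 : ℕ∞) < M.eRk A ∧ M.eRk A < (p : ℕ∞)}.ncard : ℚ) :=
  c025_ten_large_gxtb' M p hp

end ThmN

end PercRepro
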